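import Mathlib
import HarnessLib
import Literature.MathematicalPhysics.QuantumFieldTheory.ConstructiveQFTWave0
import Literature.Barriers.QuantumFields.ElitzurTheorem
import Summits.Ventures.LatticeQCDFlow.Exactness.LatticeCoordAvg
import Summits.Ventures.LatticeQCDFlow.Scaling.TorusPlaquetteGeometry
import Summits.Ventures.LatticeQCDFlow.TrivializingMaps.AbelianTorusGirth

/-!
# LatticeQCDFlow / Scaling — the second difference of the Wilson action across two plaquette-mates
# localises on their unique shared plaquette and is a square defect of the character

HONEST FRAMING: exact (Metropolis-corrected) sampling algorithms for lattice gauge theory;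
figures of merit are autocorrelation/cost numbers at stated couplings and volumes; no
continuum-physics claim.

Venture `LatticeQCDFlow` (cell pub-lqcd), topic `Scaling`, FANOUT row 30 (lean-1, GEN-15) — OUR WORK,
companion of `Scaling/AutoregressiveGaugeRedundancy{,Wilson}.lean` (THEORY-2.md §4 row C5, gauge
case).  There: with `ℓ = (x, i)`, `a = (x + e_j, i)` (`i ≠ j`, plaquette-mates) and the other links
at `x` integrated out, the exact autoregressive conditional of `U_a` does NOT read `U_ℓ` (gauge
redundancy).  This file and its sequel `Scaling/WilsonPlaquetteMateContext.lean` supply the other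
end of the same witness: with NOTHING integrated out (`s = ∅`) the exact conditional of `U_a` given
all other links DOES read `U_ℓ` — so the true context of `a` loses the plaquette-mate strictly
through marginalisation, not because the coupling was absent.  Here: the algebra and combinatorics.
Def-free; the test configurations are `C(u,v) = 1[ℓ ↦ u][a ↦ v]`.

* §1 bookkeeping: `plaquetteHolonomy_update_of_ne` (a plaquette not containing the updated link keeps
  its holonomy); the torus facts `e_k ≠ 0`, `e_μ = e_ν ⇒ μ = ν` (`L ≥ 2`), `e_μ + e_ν ≠ 0` (`L ≥ 3`)
  are the tree's `Lattice.TorusGeom.single_ne_zero`, `TrivializingMaps.Abelian.Torus.single_inj`,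
  `….single_add_single_ne_zero`; **`plaquette_eq_of_mem_mates`** (`L ≥ 3`: the ONLY plaquette containing both `ℓ` and `a` is the one
  at `x` in the `{i, j}` plane — sixteen cases sorted by the direction components).
* §2 **`wilsonAction_second_difference`**: if every plaquette but `p₀` misses `ℓ` or misses `a`, the
  second difference `S(C(u,v)) − S(C(u,1)) − S(C(1,v)) + S(C(1,1))` of the Wilson action is the second
  difference of the single term of `p₀` (`Finset.sum_eq_single`); `plaquette_misses_mate` (the
  packaged uniqueness); **`exists_sq_defect_ne_zero`**: a bounded character `χ = Re tr ρ` with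
  `χ(g₀) ≠ χ(1)` has some `u` with `χ(u²) − 2χ(u) + χ(1) ≠ 0` (otherwise
  `χ(g₀^{2^n}) − χ(1) = 2^n (χ(g₀) − χ(1))` for all `n`, unbounded).

The sequel combines these: the Wilson weight is not a product across the two plaquette-mates, and
the full exact conditional of `U_a` reads `U_ℓ`.  NOT CLAIMED: `L = 2` (two shared plaquettes; not
treated); anything probabilistic (that is the sequel); any number of ours.  Elementary over the
tree (`plaquetteHolonomy`, `wilsonAction`); no definition is introduced; nothing is cited as a fact;
no `sorry`.
-/

noncomputable section

namespace Summit.Ventures.LatticeQCDFlow.Theory2.Autoregressive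

open MeasureTheory Function
open Literature.MathematicalPhysics.QuantumFieldTheory
open Summit.Ventures.LatticeQCDFlow.Exactness

variable {d L N : ℕ} {G : Type*} [Group G]

/-! ## §1 Plaquette bookkeeping -/

section Bookkeeping

/-- A plaquette none of whose four links is the updated one keeps its holonomy. [ours] -/
theorem plaquetteHolonomy_update_of_ne (U : GaugeConfig d L G) {e : Edge d L} (g : G) {y : Site d L}
    {μ ν : Fin d} (h1 : (y, μ) ≠ e) (h2 : (y.shift μ, ν) ≠ e) (h3 : (y.shift ν, μ) ≠ e)
    (h4 : (y, ν) ≠ e) :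
    plaquetteHolonomy (update U e g) y μ ν = plaquetteHolonomy U y μ ν := by
  simp [plaquetteHolonomy, update_of_ne h1, update_of_ne h2, update_of_ne h3, update_of_ne h4]

/-- **The only plaquette containing both `ℓ = (x, i)` and `a = (x + e_j, i)` (`L ≥ 3`) is the one at
`x` in the `{i, j}` plane** (so none at all if `i = j`).  Membership of a link in the plaquette
`(y; μ, ν)`, `μ ≠ ν`, means being one of `(y, μ)`, `(y + e_μ, ν)`, `(y + e_ν, μ)`, `(y, ν)`. [ours] -/
theorem plaquette_eq_of_mem_mates (hL : 3 ≤ L) {x y : Site d L} {i j μ ν : Fin d} (hμν : μ ≠ ν)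
    (hℓ : ((x, i) : Edge d L) = (y, μ) ∨ ((x, i) : Edge d L) = (y.shift μ, ν) ∨
      ((x, i) : Edge d L) = (y.shift ν, μ) ∨ ((x, i) : Edge d L) = (y, ν))
    (ha : ((x.shift j, i) : Edge d L) = (y, μ) ∨ ((x.shift j, i) : Edge d L) = (y.shift μ, ν) ∨
      ((x.shift j, i) : Edge d L) = (y.shift ν, μ) ∨ ((x.shift j, i) : Edge d L) = (y, ν)) :
    y = x ∧ ((μ = i ∧ ν = j) ∨ (μ = j ∧ ν = i)) := by
  have hL2 : 2 ≤ L := by omega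
  have V1 := Lattice.TorusGeom.single_ne_zero (d := d) hL2 j
  have V3 := TrivializingMaps.Abelian.Torus.single_add_single_ne_zero (d := d) hL
  -- the four site patterns, once the direction components agree
  have key : ∀ k : Fin d, (x = y ∨ x = y + Pi.single k 1) →
      (x + Pi.single j 1 = y ∨ x + Pi.single j 1 = y + Pi.single k 1) → y = x ∧ k = j := by
    intro k hx hxa
    rcases hx with h1 | h1 <;> rcases hxa with h3 | h3
    · exfalso; apply V1
      have : x + Pi.single j 1 = x + 0 := by rw [add_zero, h3, ← h1]
      exact add_left_cancel this
    · refine ⟨h1.symm, ?_⟩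
      have : x + Pi.single j 1 = x + Pi.single k 1 := by rw [h3, ← h1]
      exact (TrivializingMaps.Abelian.Torus.single_inj hL2 (add_left_cancel this)).symm
    · exfalso; apply V3 k j
      have : y + (Pi.single k 1 + Pi.single j 1) = y + 0 := by rw [← add_assoc, ← h1, h3, add_zero]
      exact add_left_cancel this
    · exfalso; apply V1
      have : x + Pi.single j 1 = x + 0 := by rw [add_zero, h3, h1]
      exact add_left_cancel this
  simp only [Prod.mk.injEq, Site.shift] at hℓ ha
  -- sort the sixteen cases by the direction components (`μ ≠ ν` kills the mixed ones)
  rcases hℓ with ⟨h1, h2⟩ | ⟨h1, h2⟩ | ⟨h1, h2⟩ | ⟨h1, h2⟩ <;>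
    rcases ha with ⟨h3, h4⟩ | ⟨h3, h4⟩ | ⟨h3, h4⟩ | ⟨h3, h4⟩
  · exact (key ν (Or.inl h1) (Or.inl h3)).elim fun hy hk => ⟨hy, Or.inl ⟨h2.symm, hk⟩⟩
  · exact absurd (h2.symm.trans h4) hμν
  · exact (key ν (Or.inl h1) (Or.inr h3)).elim fun hy hk => ⟨hy, Or.inl ⟨h2.symm, hk⟩⟩
  · exact absurd (h2.symm.trans h4) hμν
  · exact absurd (h4.symm.trans h2) hμν
  · exact (key μ (Or.inr h1) (Or.inr h3)).elim fun hy hk => ⟨hy, Or.inr ⟨hk, h2.symm⟩⟩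
  · exact absurd (h4.symm.trans h2) hμν
  · exact (key μ (Or.inr h1) (Or.inl h3)).elim fun hy hk => ⟨hy, Or.inr ⟨hk, h2.symm⟩⟩
  · exact (key ν (Or.inr h1) (Or.inl h3)).elim fun hy hk => ⟨hy, Or.inl ⟨h2.symm, hk⟩⟩
  · exact absurd (h2.symm.trans h4) hμν
  · exact (key ν (Or.inr h1) (Or.inr h3)).elim fun hy hk => ⟨hy, Or.inl ⟨h2.symm, hk⟩⟩
  · exact absurd (h2.symm.trans h4) hμν
  · exact absurd (h4.symm.trans h2) hμν
  · exact (key μ (Or.inl h1) (Or.inr h3)).elim fun hy hk => ⟨hy, Or.inr ⟨hk, h2.symm⟩⟩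
  · exact absurd (h4.symm.trans h2) hμν
  · exact (key μ (Or.inl h1) (Or.inl h3)).elim fun hy hk => ⟨hy, Or.inr ⟨hk, h2.symm⟩⟩

end Bookkeeping

/-! ## §2 The second difference of the Wilson action across two plaquette-mates -/

section Defect

variable (ρ : G →* Matrix (Fin N) (Fin N) ℂ)

/-- The test configuration `1` except `U_ℓ = u`, `U_a = v` is `U_a`-updated from `(u, 1)` … [ours] -/
theorem testConfig_eq_update_snd {ℓ a : Edge d L} (u v : G) :
    update (update (1 : GaugeConfig d L G) ℓ u) a v =
      update (update (update (1 : GaugeConfig d L G) ℓ u) a 1) a v := by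
  rw [update_idem]

/-- … and `U_ℓ`-updated from `(1, v)` (`ℓ ≠ a`). [ours] -/
theorem testConfig_eq_update_fst {ℓ a : Edge d L} (hℓa : ℓ ≠ a) (u v : G) :
    update (update (1 : GaugeConfig d L G) ℓ u) a v =
      update (update (update (1 : GaugeConfig d L G) ℓ 1) a v) ℓ u := by
  have h1 : update (1 : GaugeConfig d L G) ℓ 1 = 1 := update_eq_self_iff.2 rfl
  rw [h1, update_comm hℓa]

/-- **The second difference localises on the shared plaquette.**  If `p₀` is a plaquette such that
every other plaquette misses `ℓ` or misses `a` (`ℓ ≠ a`), then over the test configurations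
`C(u,v) = 1[ℓ ↦ u][a ↦ v]` the second difference of the Wilson action is the second difference of the
single term of `p₀`:  `S(C(u,v)) − S(C(u,1)) − S(C(1,v)) + S(C(1,1)) = −(χ₀(u,v) − χ₀(u,1) − χ₀(1,v) +
χ₀(1,1))`, `χ₀(u,v) = Re tr ρ(hol_{p₀} C(u,v))`. [ours] -/
theorem wilsonAction_second_difference [NeZero L] (p₀ : Plaquette d L) {ℓ a : Edge d L} (hℓa : ℓ ≠ a)
    (huniq : ∀ p : Plaquette d L, p ≠ p₀ →
      ((p.1, p.2.1.1) ≠ ℓ ∧ (p.1.shift p.2.1.1, p.2.1.2) ≠ ℓ ∧ (p.1.shift p.2.1.2, p.2.1.1) ≠ ℓ ∧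
          (p.1, p.2.1.2) ≠ ℓ) ∨
        ((p.1, p.2.1.1) ≠ a ∧ (p.1.shift p.2.1.1, p.2.1.2) ≠ a ∧ (p.1.shift p.2.1.2, p.2.1.1) ≠ a ∧
          (p.1, p.2.1.2) ≠ a))
    (u v : G) :
    let C : G → G → GaugeConfig d L G := fun u v => update (update 1 ℓ u) a v
    let χ₀ : G → G → ℝ := fun u v => (ρ (plaquetteHolonomy (C u v) p₀.1 p₀.2.1.1 p₀.2.1.2)).trace.re
    wilsonAction ρ (C u v) - wilsonAction ρ (C u 1) - wilsonAction ρ (C 1 v) + wilsonAction ρ (C 1 1) =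
      -(χ₀ u v - χ₀ u 1 - χ₀ 1 v + χ₀ 1 1) := by
  intro C χ₀
  unfold wilsonAction
  rw [← Finset.sum_sub_distrib, ← Finset.sum_sub_distrib, ← Finset.sum_add_distrib]
  rw [Finset.sum_eq_single p₀]
  · simp only [χ₀]; ring
  · intro p _ hp
    rcases huniq p hp with ⟨h1, h2, h3, h4⟩ | ⟨h1, h2, h3, h4⟩
    · -- `p` misses `ℓ`: `C(u,·)` and `C(1,·)` have the same holonomy around `p`
      have e1 : plaquetteHolonomy (C u v) p.1 p.2.1.1 p.2.1.2 =
          plaquetteHolonomy (C 1 v) p.1 p.2.1.1 p.2.1.2 := by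
        simp only [C]
        rw [testConfig_eq_update_fst hℓa u v, plaquetteHolonomy_update_of_ne _ _ h1 h2 h3 h4]
      have e2 : plaquetteHolonomy (C u 1) p.1 p.2.1.1 p.2.1.2 =
          plaquetteHolonomy (C 1 1) p.1 p.2.1.1 p.2.1.2 := by
        simp only [C]
        rw [testConfig_eq_update_fst hℓa u 1, plaquetteHolonomy_update_of_ne _ _ h1 h2 h3 h4]
      rw [e1, e2]; ring
    · -- `p` misses `a`
      have e1 : plaquetteHolonomy (C u v) p.1 p.2.1.1 p.2.1.2 =
          plaquetteHolonomy (C u 1) p.1 p.2.1.1 p.2.1.2 := by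
        simp only [C]
        rw [testConfig_eq_update_snd u v, plaquetteHolonomy_update_of_ne _ _ h1 h2 h3 h4]
      have e2 : plaquetteHolonomy (C 1 v) p.1 p.2.1.1 p.2.1.2 =
          plaquetteHolonomy (C 1 1) p.1 p.2.1.1 p.2.1.2 := by
        simp only [C]
        rw [testConfig_eq_update_snd 1 v, plaquetteHolonomy_update_of_ne _ _ h1 h2 h3 h4]
      rw [e1, e2]; ring
  · intro h; exact absurd (Finset.mem_univ p₀) h

/-- **Uniqueness of the shared plaquette, packaged for `wilsonAction_second_difference`**: for
`L ≥ 3`, `μ < ν` with `{μ, ν} = {i, j}` as below, every plaquette other than `(x; μ, ν)` misses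
`ℓ = (x, i)` or misses `a = (x + e_j, i)`. [ours] -/
theorem plaquette_misses_mate (hL : 3 ≤ L) (x : Site d L) {i j : Fin d} {μ ν : Fin d} (hμν : μ < ν)
    (hdir : (μ = i ∧ ν = j) ∨ (μ = j ∧ ν = i)) (p : Plaquette d L)
    (hp : p ≠ (x, ⟨(μ, ν), hμν⟩)) :
    ((p.1, p.2.1.1) ≠ (x, i) ∧ (p.1.shift p.2.1.1, p.2.1.2) ≠ (x, i) ∧
        (p.1.shift p.2.1.2, p.2.1.1) ≠ (x, i) ∧ (p.1, p.2.1.2) ≠ (x, i)) ∨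
      ((p.1, p.2.1.1) ≠ (x.shift j, i) ∧ (p.1.shift p.2.1.1, p.2.1.2) ≠ (x.shift j, i) ∧
        (p.1.shift p.2.1.2, p.2.1.1) ≠ (x.shift j, i) ∧ (p.1, p.2.1.2) ≠ (x.shift j, i)) := by
  by_contra hcon
  rw [not_or] at hcon
  obtain ⟨hℓ, ha⟩ := hcon
  simp only [not_and_or, not_not] at hℓ ha
  have hℓ' : ((x, i) : Edge d L) = (p.1, p.2.1.1) ∨ ((x, i) : Edge d L) = (p.1.shift p.2.1.1, p.2.1.2) ∨
      ((x, i) : Edge d L) = (p.1.shift p.2.1.2, p.2.1.1) ∨ ((x, i) : Edge d L) = (p.1, p.2.1.2) := by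
    rcases hℓ with h | h | h | h
    · exact Or.inl h.symm
    · exact Or.inr (Or.inl h.symm)
    · exact Or.inr (Or.inr (Or.inl h.symm))
    · exact Or.inr (Or.inr (Or.inr h.symm))
  have ha' : ((x.shift j, i) : Edge d L) = (p.1, p.2.1.1) ∨
      ((x.shift j, i) : Edge d L) = (p.1.shift p.2.1.1, p.2.1.2) ∨
      ((x.shift j, i) : Edge d L) = (p.1.shift p.2.1.2, p.2.1.1) ∨
      ((x.shift j, i) : Edge d L) = (p.1, p.2.1.2) := by
    rcases ha with h | h | h | h
    · exact Or.inl h.symm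
    · exact Or.inr (Or.inl h.symm)
    · exact Or.inr (Or.inr (Or.inl h.symm))
    · exact Or.inr (Or.inr (Or.inr h.symm))
  obtain ⟨hy, hd⟩ := plaquette_eq_of_mem_mates hL (ne_of_lt p.2.2) hℓ' ha'
  apply hp
  -- the directions of `p` are `(μ, ν)`: the only increasing arrangement of `{i, j}`
  have hμν' : p.2.1.1 = μ ∧ p.2.1.2 = ν := by
    have hlt := p.2.2
    rcases hd with ⟨h1, h2⟩ | ⟨h1, h2⟩ <;> rcases hdir with ⟨h3, h4⟩ | ⟨h3, h4⟩
    · exact ⟨h1.trans h3.symm, h2.trans h4.symm⟩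
    · exfalso; rw [h1, h2] at hlt; rw [h3, h4] at hμν; exact lt_asymm hlt hμν
    · exfalso; rw [h1, h2] at hlt; rw [h3, h4] at hμν; exact lt_asymm hlt hμν
    · exact ⟨h1.trans h3.symm, h2.trans h4.symm⟩
  obtain ⟨hp1, hp2⟩ := hμν'
  refine Prod.ext hy (Subtype.ext (Prod.ext hp1 hp2))

/-- **A bounded non-constant character has a square defect**: if `|Re tr ρ| ≤ C` and
`Re tr ρ(g₀) ≠ Re tr ρ(1)` for some `g₀`, then `Re tr ρ(u²) − 2 Re tr ρ(u) + Re tr ρ(1) ≠ 0` for some `u`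
(otherwise `Re tr ρ(g₀^{2^n}) − Re tr ρ(1) = 2^n (Re tr ρ(g₀) − Re tr ρ(1))` for all `n`, unbounded).
[ours] -/
theorem exists_sq_defect_ne_zero (hbd : ∃ C : ℝ, ∀ g : G, |(ρ g).trace.re| ≤ C)
    (hnc : ∃ g : G, (ρ g).trace.re ≠ (ρ 1).trace.re) :
    ∃ u : G, (ρ (u * u)).trace.re - 2 * (ρ u).trace.re + (ρ 1).trace.re ≠ 0 := by
  by_contra hall'
  have hall : ∀ u : G, (ρ (u * u)).trace.re - 2 * (ρ u).trace.re + (ρ 1).trace.re = 0 :=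
    fun u => not_not.mp (not_exists.mp hall' u)
  obtain ⟨C, hC⟩ := hbd
  obtain ⟨g₀, hg₀⟩ := hnc
  set δ : ℝ := (ρ g₀).trace.re - (ρ 1).trace.re with hδ
  have hδ0 : δ ≠ 0 := sub_ne_zero.2 hg₀
  have hiter : ∀ n : ℕ, (ρ (g₀ ^ 2 ^ n)).trace.re - (ρ 1).trace.re = 2 ^ n * δ := by
    intro n
    induction n with
    | zero => simp [hδ]
    | succ n ih =>
      have hsq : g₀ ^ 2 ^ (n + 1) = g₀ ^ 2 ^ n * g₀ ^ 2 ^ n := by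
        rw [pow_succ, pow_mul, sq]
      have h := hall (g₀ ^ 2 ^ n)
      rw [hsq]
      calc (ρ (g₀ ^ 2 ^ n * g₀ ^ 2 ^ n)).trace.re - (ρ 1).trace.re
          = 2 * ((ρ (g₀ ^ 2 ^ n)).trace.re - (ρ 1).trace.re) := by linarith
        _ = 2 ^ (n + 1) * δ := by rw [ih, pow_succ]; ring
  -- `|2^n δ| ≤ 2C` for all `n` is impossible
  have hbound : ∀ n : ℕ, (2 : ℝ) ^ n * |δ| ≤ 2 * |C| := by
    intro n
    have h := hiter n
    have h1 := hC (g₀ ^ 2 ^ n)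
    have h2 := hC 1
    have hC' : C ≤ |C| := le_abs_self C
    calc (2 : ℝ) ^ n * |δ| = |2 ^ n * δ| := by rw [abs_mul, abs_of_pos (by positivity : (0 : ℝ) < 2 ^ n)]
      _ = |(ρ (g₀ ^ 2 ^ n)).trace.re - (ρ 1).trace.re| := by rw [h]
      _ ≤ |(ρ (g₀ ^ 2 ^ n)).trace.re| + |(ρ 1).trace.re| := abs_sub _ _
      _ ≤ 2 * |C| := by linarith
  obtain ⟨n, hn⟩ := pow_unbounded_of_one_lt (2 * |C| / |δ|) (by norm_num : (1 : ℝ) < 2)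
  have hδpos : 0 < |δ| := abs_pos.2 hδ0
  have := hbound n
  rw [div_lt_iff₀ hδpos] at hn
  linarith

end Defect

/-! ## §3 (GEN-16) The Wilson weight is not a product across two plaquette-mates -/

section NotProduct

variable (ρ : G →* Matrix (Fin N) (Fin N) ℂ)

/-- The three links `(x + e_i, j)`, `(x, j)` (the other two links of the shared plaquette) and the
pair `ℓ = (x, i)`, `a = (x + e_j, i)` are pairwise distinct where needed (`i ≠ j`, `L ≥ 2`). [ours] -/
theorem mates_distinct (hL : 2 ≤ L) (x : Site d L) {i j : Fin d} (hij : i ≠ j) :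
    ((x, i) : Edge d L) ≠ (x.shift j, i) ∧ ((x.shift i, j) : Edge d L) ≠ (x, i) ∧
      ((x.shift i, j) : Edge d L) ≠ (x.shift j, i) ∧ ((x, j) : Edge d L) ≠ (x, i) ∧
      ((x, j) : Edge d L) ≠ (x.shift j, i) := by
  have hji : j ≠ i := fun h => hij h.symm
  refine ⟨fun h => ?_, fun h => hji (congrArg Prod.snd h), fun h => hji (congrArg Prod.snd h),
    fun h => hji (congrArg Prod.snd h), fun h => hji (congrArg Prod.snd h)⟩
  have h1 : x = x.shift j := congrArg Prod.fst h
  have : x + Pi.single j 1 = x + 0 := by rw [add_zero]; exact h1.symm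
  exact Lattice.TorusGeom.single_ne_zero hL j (add_left_cancel this)

/-- **The Wilson weight genuinely couples plaquette-mates.**  `L ≥ 3`, `i ≠ j`, `β ≠ 0`, `Re tr ρ`
bounded and not constant; `ℓ = (x, i)`, `a = (x + e_j, i)`.  Then `w = e^{−β S_W}` is NOT of the
form `f(U)·g(U)` with `f` blind to `U_ℓ` and `g` blind to `U_a`: otherwise the second difference of
`S_W` over the test configurations `1[ℓ ↦ u][a ↦ v]` would vanish, but it is a square defect of the
character (`wilsonAction_second_difference`, `plaquette_misses_mate`, `exists_sq_defect_ne_zero`).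
[ours] -/
theorem wilsonWeight_not_productForm_mates [NeZero L] (hL : 3 ≤ L) (x : Site d L) {i j : Fin d}
    (hij : i ≠ j) {β : ℝ} (hβ : β ≠ 0) (hbd : ∃ C : ℝ, ∀ g : G, |(ρ g).trace.re| ≤ C)
    (hnc : ∃ g : G, (ρ g).trace.re ≠ (ρ 1).trace.re) :
    ¬ ∃ f g : GaugeConfig d L G → ℝ,
      (∀ U h, f (update U (x, i) h) = f U) ∧ (∀ U h, g (update U (x.shift j, i) h) = g U) ∧
      ∀ U, Real.exp (-β * wilsonAction ρ U) = f U * g U := by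
  rintro ⟨f, g, hf, hg, hw⟩
  have hL2 : 2 ≤ L := by omega
  obtain ⟨hℓa, hm1, hm2, hm3, hm4⟩ := mates_distinct hL2 x hij
  set ℓ : Edge d L := (x, i) with hℓdef
  set a : Edge d L := (x.shift j, i) with hadef
  set C : G → G → GaugeConfig d L G := fun u v => update (update 1 ℓ u) a v with hC
  -- product form forces the second difference of `S_W` over `C` to vanish
  have hprod : ∀ u v : G, wilsonAction ρ (C u v) - wilsonAction ρ (C u 1) - wilsonAction ρ (C 1 v) +
      wilsonAction ρ (C 1 1) = 0 := by
    intro u v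
    have e1 : f (C u v) = f (C 1 v) := by
      simp only [hC]; rw [testConfig_eq_update_fst hℓa u v, hf]
    have e2 : f (C u 1) = f (C 1 1) := by
      simp only [hC]; rw [testConfig_eq_update_fst hℓa u 1, hf]
    have e3 : g (C u v) = g (C u 1) := by
      simp only [hC]; rw [testConfig_eq_update_snd u v, hg]
    have e4 : g (C 1 v) = g (C 1 1) := by
      simp only [hC]; rw [testConfig_eq_update_snd (1 : G) v, hg]
    have key : Real.exp (-β * wilsonAction ρ (C u v)) * Real.exp (-β * wilsonAction ρ (C 1 1)) =
        Real.exp (-β * wilsonAction ρ (C u 1)) * Real.exp (-β * wilsonAction ρ (C 1 v)) := by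
      rw [hw, hw, hw, hw, e1, e2, e3, e4]; ring
    rw [← Real.exp_add, ← Real.exp_add] at key
    have key' := Real.exp_injective key
    have : β * (wilsonAction ρ (C u v) - wilsonAction ρ (C u 1) - wilsonAction ρ (C 1 v) +
        wilsonAction ρ (C 1 1)) = 0 := by linarith
    rcases mul_eq_zero.1 this with h | h
    · exact absurd h hβ
    · exact h
  -- but it is a square defect of the character on the shared plaquette
  obtain ⟨u₁, hu₁⟩ := exists_sq_defect_ne_zero ρ hbd hnc
  -- the test configuration on the four links of the shared plaquette
  have ev : ∀ u v : G, C u v (x, i) = u ∧ C u v (x.shift j, i) = v ∧ C u v (x.shift i, j) = 1 ∧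
      C u v (x, j) = 1 := by
    intro u v
    simp only [hC, hℓdef, hadef]
    refine ⟨?_, ?_, ?_, ?_⟩
    · rw [update_of_ne hℓa, update_self]
    · rw [update_self]
    · rw [update_of_ne hm2, update_of_ne hm1]; rfl
    · rw [update_of_ne hm4, update_of_ne hm3]; rfl
  rcases lt_or_gt_of_ne hij with hlt | hgt
  · -- shared plaquette `(x; i, j)`, holonomy `u · v⁻¹`; test values `(u₁, u₁⁻¹)`
    have hsd := wilsonAction_second_difference ρ ((x, ⟨(i, j), hlt⟩) : Plaquette d L) hℓa
      (fun p hp => plaquette_misses_mate hL x hlt (Or.inl ⟨rfl, rfl⟩) p hp) u₁ u₁⁻¹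
    dsimp only at hsd
    have hh : ∀ u v : G,
        plaquetteHolonomy (update (update (1 : GaugeConfig d L G) ℓ u) a v) x i j = u * v⁻¹ := by
      intro u v
      obtain ⟨e1, e2, e3, e4⟩ := ev u v
      simp only [hC] at e1 e2 e3 e4
      rw [plaquetteHolonomy, ← hℓdef, ← hadef, e1, e2, e3, e4]
      simp
    rw [hh, hh, hh, hh] at hsd
    have h0 := hprod u₁ u₁⁻¹
    simp only [hC] at h0
    rw [h0] at hsd
    simp only [inv_inv, inv_one, mul_one, one_mul] at hsd
    apply hu₁
    linarith
  · -- shared plaquette `(x; j, i)`, holonomy `v · u⁻¹`; test values `(u₁⁻¹, u₁)`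
    have hsd := wilsonAction_second_difference ρ ((x, ⟨(j, i), hgt⟩) : Plaquette d L) hℓa
      (fun p hp => plaquette_misses_mate hL x hgt (Or.inr ⟨rfl, rfl⟩) p hp) u₁⁻¹ u₁
    dsimp only at hsd
    have hh : ∀ u v : G,
        plaquetteHolonomy (update (update (1 : GaugeConfig d L G) ℓ u) a v) x j i = v * u⁻¹ := by
      intro u v
      obtain ⟨e1, e2, e3, e4⟩ := ev u v
      simp only [hC] at e1 e2 e3 e4
      rw [plaquetteHolonomy, ← hℓdef, ← hadef, e1, e2, e3, e4]
      simp
    rw [hh, hh, hh, hh] at hsd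
    have h0 := hprod u₁⁻¹ u₁
    simp only [hC] at h0
    rw [h0] at hsd
    simp only [inv_inv, inv_one, mul_one, one_mul] at hsd
    apply hu₁
    linarith

end NotProduct

end Summit.Ventures.LatticeQCDFlow.Theory2.Autoregressive

end
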